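import Literature.Geometry.Lorentzian.DecaySymbols
import Mathlib.Analysis.Calculus.ContDiff.Bounds
import HarnessLib

/-!
# Smooth symbols at infinity: bounded bilinear pairings of symbols

Support file (all results proved, no definitions, no named facts), an addition to the symbol
calculus `IsBigOSmooth` of `DecaySymbols.lean`: if `f = O_k(r^a)` and `g = O_k(r^b)` are smooth
symbols with values in normed spaces `V`, `W` and `B : V →L W →L X` is a bounded bilinear map, then
`y ↦ B (f y) (g y)` is a smooth symbol of order `a + b` (`IsBigOSmooth.bilinear`; Leibniz:
`‖∂^m B(f, g)‖ ≤ ‖B‖ Σ (m choose i) ‖∂^i f‖ ‖∂^{m-i} g‖`, Mathlib's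
`ContinuousLinearMap.norm_iteratedFDerivWithin_le_of_bilinear`). The case used for tensor fields
in Cartesian charts is the tensor product of a covector symbol with a vector symbol
(`IsBigOSmooth.smulRight`: `y ↦ (φ y) ⊗ (ψ y) = (φ y).smulRight (ψ y)`), e.g. for the second
fundamental form `α⁻¹(k₁ (dR ⊗ ϖ + ϖ ⊗ dR) + k₂ (dμ ⊗ ϖ + ϖ ⊗ dμ))` of the Boyer–Lindquist slice of
Kerr.

References: R. Bartnik, CPAM 39 (1986), Def. 2.1 and Prop. 2.2 (weighted classes form an algebra);
R. Schoen, S.-T. Yau, Comm. Math. Phys. 65 (1979), §1, (1.1).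
-/

noncomputable section

open Filter Asymptotics Bornology Set
open scoped Topology ContDiff

namespace Literature.Geometry.Lorentzian

namespace IsBigOSmooth

variable {E : Type*} [NormedAddCommGroup E] [InnerProductSpace ℝ E]
  {V : Type*} [NormedAddCommGroup V] [NormedSpace ℝ V]
  {W : Type*} [NormedAddCommGroup W] [NormedSpace ℝ W]
  {X : Type*} [NormedAddCommGroup X] [NormedSpace ℝ X]
  {k : ℕ} {a b : ℝ}

/-- **Bounded bilinear pairings of symbols (Leibniz rule).** If `f = O_k(r^a)` and `g = O_k(r^b)`
are smooth symbols and `B` is a bounded bilinear map, then `B(f, g) = O_k(r^{a+b})`: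
`‖∂^m B(f, g)‖ ≤ ‖B‖ Σ (m choose i) ‖∂^i f‖ ‖∂^{m−i} g‖` and `r^{a−i} r^{b−(m−i)} = r^{a+b−m}`.
Bartnik 1986, Prop. 2.2. [cite: Bartnik1986, Prop. 2.2] -/
theorem bilinear (B : V →L[ℝ] W →L[ℝ] X) {f : E → V} {g : E → W} (hf : IsBigOSmooth k a f)
    (hg : IsBigOSmooth k b g) : IsBigOSmooth k (a + b) fun y ↦ B (f y) (g y) := by
  obtain ⟨⟨R₁, hR₁⟩, hfO⟩ := hf
  obtain ⟨⟨R₂, hR₂⟩, hgO⟩ := hg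
  set s : Set E := {y | max R₁ R₂ < ‖y‖} with hs_def
  have hs : IsOpen s := isOpen_setOf_lt_norm _
  have hfs : ContDiffOn ℝ ∞ f s := hR₁.mono (setOf_lt_norm_anti (le_max_left _ _))
  have hgs : ContDiffOn ℝ ∞ g s := hR₂.mono (setOf_lt_norm_anti (le_max_right _ _))
  refine ⟨⟨max R₁ R₂, B.isBoundedBilinearMap.contDiff.comp_contDiffOn (hfs.prodMk hgs)⟩,
    fun m hm ↦ ?_⟩
  -- the Leibniz bound on the far region
  have key : ∀ y ∈ s, ‖iteratedFDeriv ℝ m (fun y ↦ B (f y) (g y)) y‖ ≤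
      ‖B‖ * ∑ i ∈ Finset.range (m + 1), (m.choose i : ℝ) * ‖iteratedFDeriv ℝ i f y‖ *
        ‖iteratedFDeriv ℝ (m - i) g y‖ := by
    intro y hy
    calc ‖iteratedFDeriv ℝ m (fun y ↦ B (f y) (g y)) y‖
        = ‖iteratedFDerivWithin ℝ m (fun y ↦ B (f y) (g y)) s y‖ := by
          rw [iteratedFDerivWithin_of_isOpen m hs hy]
      _ ≤ ‖B‖ * ∑ i ∈ Finset.range (m + 1), (m.choose i : ℝ) * ‖iteratedFDerivWithin ℝ i f s y‖ *
            ‖iteratedFDerivWithin ℝ (m - i) g s y‖ :=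
          B.norm_iteratedFDerivWithin_le_of_bilinear hfs hgs hs.uniqueDiffOn hy (natCast_le_infty m)
      _ = _ := by
          congr 1
          refine Finset.sum_congr rfl fun i _ ↦ ?_
          rw [iteratedFDerivWithin_of_isOpen i hs hy, iteratedFDerivWithin_of_isOpen (m - i) hs hy]
  -- each Leibniz term is `O(r^{a+b-m})`
  have hterm : ∀ i ∈ Finset.range (m + 1),
      (fun y ↦ (m.choose i : ℝ) * ‖iteratedFDeriv ℝ i f y‖ * ‖iteratedFDeriv ℝ (m - i) g y‖)
        =O[cobounded E] fun x ↦ ‖x‖ ^ (a + b - m) := by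
    intro i hi
    have him : i ≤ m := Nat.lt_succ_iff.1 (Finset.mem_range.1 hi)
    have h1 := (hfO i (him.trans hm)).const_mul_left (m.choose i : ℝ)
    have h2 := hgO (m - i) ((Nat.sub_le m i).trans hm)
    refine (h1.mul h2).trans (EventuallyEq.isBigO ?_)
    refine (norm_rpow_mul_rpow_eventuallyEq (E := E) (a - i) (b - (m - i : ℕ))).trans ?_
    refine Eventually.of_forall fun x ↦ ?_
    rw [Nat.cast_sub him]
    ring_nf
  have hsum := (IsBigO.sum hterm).const_mul_left ‖B‖
  have H : ∀ᶠ y in cobounded E, ‖iteratedFDeriv ℝ m (fun y ↦ B (f y) (g y)) y‖ ≤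
      ‖B‖ * ∑ i ∈ Finset.range (m + 1), (m.choose i : ℝ) * ‖iteratedFDeriv ℝ i f y‖ *
        ‖iteratedFDeriv ℝ (m - i) g y‖ := by
    filter_upwards [eventually_cobounded_lt_norm (E := E) (max R₁ R₂)] with y hy
    exact key y hy
  exact (IsBigO.of_norm_eventuallyLE
    (H.mono fun x hx ↦ (Real.norm_of_nonneg (norm_nonneg _)).trans_le hx)).trans hsum

/-- **Tensor products of symbols**: for a covector symbol `φ = O_k(r^a)` (`φ y : V →L ℝ`) and a
vector symbol `ψ = O_k(r^b)`, the field `y ↦ φ y ⊗ ψ y = (φ y).smulRight (ψ y)` is `O_k(r^{a+b})`.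
[cite: Bartnik1986, Prop. 2.2] -/
theorem smulRight {φ : E → V →L[ℝ] ℝ} {ψ : E → W} (hφ : IsBigOSmooth k a φ) (hψ : IsBigOSmooth k b ψ) :
    IsBigOSmooth k (a + b) fun y ↦ (φ y).smulRight (ψ y) :=
  (bilinear (ContinuousLinearMap.smulRightL ℝ V W) hφ hψ).congr fun _ ↦ rfl

end IsBigOSmooth

end Literature.Geometry.Lorentzian

end
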